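import Summits.BirchSwinnertonDyer.BirchSwinnertonDyer.Theorems.ClassRecordThreeCornerAtThreeShimuraSwapFamilyLevelRaising
import Summits.BirchSwinnertonDyer.BirchSwinnertonDyer.Theorems.ClassRecordThreeCornerAtThreeShimuraWalkEndGlue
import Summits.BirchSwinnertonDyer.BirchSwinnertonDyer.Theorems.Rank1ResidualJetSwapLevelRaisingLiterature
import Summits.BirchSwinnertonDyer.BirchSwinnertonDyer.Theorems.ClassRecordThreeEulerHalvesAtThreeWalkCebotarev
import HarnessLib

/-!
# PORT-SPEC (P1), file 5: the END GLUE's binder `hswapF` (corner3-p2 g8, `ShimuraWalk.swapSupplyAt_of_familySwapSupply`, p598543) —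
# Kolyvagin's prime swap for the DATA OF A FAMILY `ys` in GROSS currency on both sides — FROM {Poitou–Tate for Selmer structures (named
# fact), `E(K)[p] = 0`, a Gross-currency Čebotarev supply, the family dictionary}; hence `ShimuraWalk.SwapSupplyAt hK ι W N_E p ys` from the
# same plus the weak (B4) label (cell `bsd-stepL`, seat `bsd-stepL-corner-p1` g15; `--supports stmt-BirchSwinnertonDyer-21420 --as helper`)

WHAT. (1) `Swap.familySwapSupply_of_dictionary`: for `W/ℚ` globally minimal, `K` imaginary quadratic with `d_K ∉ {−3, −4}`, `p` odd, `ι`, a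
family `ys : (m : ℕ) → E(K[m])`: the statement `hswapF` of the end glue — «for all `μ e` and every family datum `d` (`d.y = ys n`) on a
square-free `n` over Gross–Kolyvagin primes with `Frob = Frob_∞` on `K(E[p^{μ+1}])`, if every such datum is `p^μ`-divisible and `d` is not
`p^{μ+1}`-divisible, some family datum on such a conductor with `Frob = Frob_∞` on `K(E[p^e])` is not `p^{μ+1}`-divisible» — FOLLOWS from:
(i) the named Literature fact `poitouTate_selmerStructure_duality_conj` (yielding, exactly as in bsd-jet's `levelRaising_of_literature`, the
level-`p` Poitou–Tate package and — with the tree's Weil datum and global intrinsic transverse family — the local inputs `h𝒯σ` ∕ `h𝒯sd` ∕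
`hloc` ∕ `hdisj`; block COPIED verbatim); (ii) `E(K)[p] = 0` (`hbot`); (iii) a Čebotarev supply `hceb` in Gross's currency (McCallum Cor. 3.2 ∕
Jetchev Lemma 5.1 for a pair of opposite `τ`-eigenclasses in `H¹(K, E[p])`, primes with `IsKolyvaginPrime ∧ FrobEqFrobInfty (p^{1+j})` beyond
any bound — KERNEL for `ρ̄` onto and for `E[p]` irreducible with `−1 ∈ ρ̄(Γ_ℚ)`: file 6 `Koly.hceb_family_of_surj` ∕ `…_of_irr_of_neg`);
(iv) the FAMILY DICTIONARY of file 4 for every depth `u`, on the pool «square-free, every prime factor Gross–Kolyvagin with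
`FrobEqFrobInfty (p^{u+1})`», for every presentation `d` with `d.y = ys m`: standing inputs `hA` ∕ `hP` (Gross 4.3 ∕ 3.6), the `τ`-sign
`hsign` (Gross 5.3–5.4 ∕ label (B3)), the Selmer membership of the level-`p` root classes `hsel` for the global intrinsic transverse family
(Gross 6.2 (1), McCallum 4.3, [GZ86 III (3.1)] ∕ label (B6)), McCallum Prop. 4.4 for any two presentations `h44` (Gross 3.7 ∕ labels
(B4)+(B5)). The presentations themselves come for free (`ShimuraWalk.exists_familyData_y_eq`, corner3-p2 g8) and MINIMALITY is the inner
hypothesis of `hswapF`. (2) `Swap.shimuraWalk_swapSupplyAt_of_family`: `ShimuraWalk.SwapSupplyAt hK ι W N_E p ys` from the same inputs and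
the weak (B4) label, through corner3-p2's `ShimuraWalk.swapSupplyAt_of_familySwapSupply`. PROOF of (1): pool `KP q := IsKolyvaginPrime ∧
FrobEqFrobInfty (p^{μ+1})`, target `Fine q := FrobEqFrobInfty (p^e)`; Gross ⟹ Zhang (`Koly.zhang_isKolyvaginPrime_of_frobEqFrobInfty`);
`hceb` at shift `j := μ + e` lands in `KP ∩ Fine` (`FrobEqFrobInfty.of_dvd`); run file 4 (`exists_conductor_fine_of_minDepth_family`).
HONEST FRAMING: two theorems, no definition ∕ fact ∕ sorry; CONDITIONAL on the named fact (i) and the displayed inputs (ii)–(iv) (+ (B4) in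
(2)) — NONE of which is supplied here for the labelled CM family of `X_{N⁺,N⁻}` (lanes corner3-p2 ∕ tam3-p1 own those producers);
`SwapSupplyAtThree[B6]` is NOT discharged; nothing about any curve; no stub ∕ item closes; BSD is not proved by any of this; T7.
Credit: bsd-jet pv-2 (packages), corner3-p2 g7∕g8 (target, end glue, dictionary), tam3-p1 (family datum).
References (locators only): [cite: McCallumLMS1991, §5 Prop. 5.2 and proof (pp. 304–306), §3 Cor. 3.2] [cite: Jetchev2008, Lemma 5.1,
Lemma 5.2] [cite: GrossLMS1991, §3 (3.2)–(3.3), Prop. 3.6, Prop. 9.6] [cite: MilneADT2006, Ch. I, Thm. 4.10(b)] [cite: BurungaleEtAl2026, Prop. 2.2.1].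
presearch: not applicable (assembly of tree theorems). Design: no definitions; `K : Type`. Axioms: `propext`, `Classical.choice`, `Quot.sound`.
-/

set_option autoImplicit false

noncomputable section

open scoped Classical Pointwise
open Function NumberField IsDedekindDomain WeierstrassCurve Field
open Literature.NumberTheory.EllipticCurves Literature.NumberTheory.GaloisRepresentations
open Literature.NumberTheory.EllipticCurves.Jetchev2008 Literature.NumberTheory.EllipticCurves.KolyvaginCocycle
open Literature.NumberTheory.EllipticCurves.ModularForms
open Literature.NumberTheory.GaloisCohomology Literature.NumberTheory.Automorphic
open Literature.NumberTheory.GaloisRepresentations.DiscreteGaloisModule (transverseSubgroup SelmerStructure)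
open Summit.BirchSwinnertonDyer.Rank1Residual.JET.SelmerVocabulary
open Summit.BirchSwinnertonDyer.Rank1Residual.JET.GlobalDuality
open Summit.BirchSwinnertonDyer.Rank1Residual.X11b
open Summit.BirchSwinnertonDyer.Rank1Residual.X11b.Three
open Summit.BirchSwinnertonDyer.Rank1Residual.X11b.Three.Koly
open Summit.BirchSwinnertonDyer.BirchSwinnertonDyer.Theorems

namespace Summit.BirchSwinnertonDyer.Rank1Residual.JET.Swap

variable {K : Type} [Field K] [NumberField K] (W : WeierstrassCurve ℚ) [W.IsElliptic] [W.IsGloballyMinimal]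
  [NeZero (W.conductorNorm ℤ)]

omit [NeZero (W.conductorNorm ℤ)] in
set_option maxHeartbeats 800000 in
/-- **The end glue's `hswapF` for an arbitrary family from {Poitou–Tate (named fact), `E(K)[p] = 0`, Gross-currency Čebotarev, the family
dictionary}** — see the module docstring for the inputs (i)–(iv) and the proof. CONDITIONAL on every displayed input.
[cite: McCallumLMS1991, §5 Prop. 5.2 (p. 304)] [cite: Jetchev2008, Lemma 5.1, Lemma 5.2 (iii)] [cite: GrossLMS1991, §3 (3.2), Prop. 3.6] -/
theorem familySwapSupply_of_dictionary
    (hPT : ∀ (K : Type) [Field K] [NumberField K], poitouTate_selmerStructure_duality_conj K)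
    (hK : IsImaginaryQuadratic K) (hD3 : NumberField.discr K ≠ -3) (hD4 : NumberField.discr K ≠ -4)
    (p : ℕ) [Fact p.Prime] (hp2 : p ≠ 2) (ι : K →+* ℂ) [∀ j : ℕ, NumberField (ringClassField K ι j)]
    (ys : (m : ℕ) → (W.baseChange (ringClassField K ι m)).toAffine.Point)
    (hbot : AddSubgroup.torsionBy (W.baseChange K).toAffine.Point (p : ℤ) = ⊥)
    -- (iii) Čebotarev in Gross's currency for a pair of opposite eigenclasses at level `p`, with Frobenius shift `j`
    (hceb : ∀ (τ : K ≃ₐ[ℚ] K), τ ≠ 1 → ∀ (j : ℕ) (e₁ : ℤ), (e₁ = 1 ∨ e₁ = -1) →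
      ∀ (x y : galoisCohomology ((W.baseChange K).torsionGaloisModule ((p ^ 1 : ℕ) : ℤ)) 1),
      conjAct W τ ((p ^ 1 : ℕ) : ℤ) x = e₁ • x → conjAct W τ ((p ^ 1 : ℕ) : ℤ) y = (-e₁) • y → y ≠ 0 →
      ∀ (b : ℕ), ∃ ℓ : ℕ, b < ℓ ∧ IsKolyvaginPrime (W.conductorNorm ℤ) W K p ℓ ∧ FrobEqFrobInfty W K (p ^ (1 + j)) ℓ ∧
        ∀ v : HeightOneSpectrum (𝓞 K), (ℓ : 𝓞 K) ∈ v.asIdeal →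
          addOrderOf (galoisCohomology.localization
              ((W.baseChange K).torsionGaloisModule ((p ^ 1 : ℕ) : ℤ)) (Sum.inr v) 1 x) = addOrderOf x ∧
          addOrderOf (galoisCohomology.localization
              ((W.baseChange K).torsionGaloisModule ((p ^ 1 : ℕ) : ℤ)) (Sum.inr v) 1 y) = addOrderOf y)
    -- (iv) the family dictionary on the Gross-pool «Frob = Frob_∞ on K(E[p^{u+1}])», every `u`, every presentation
    (hA : ∀ (u m : ℕ) (dm : KolyvaginFamilyData W K ι m), dm.y = ys m → Squarefree m →
      (∀ q ∈ m.primeFactors, IsKolyvaginPrime (W.conductorNorm ℤ) W K p q ∧ FrobEqFrobInfty W K (p ^ (u + 1)) q) →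
      IsAdmissible (absoluteGaloisGroup K) dm.pointsSubgroup ((p ^ (1 + u) : ℕ) : ℤ))
    (hP : ∀ (u m : ℕ) (dm : KolyvaginFamilyData W K ι m), dm.y = ys m → Squarefree m →
      (∀ q ∈ m.primeFactors, IsKolyvaginPrime (W.conductorNorm ℤ) W K p q ∧ FrobEqFrobInfty W K (p ^ (u + 1)) q) →
      dm.toGeomPoints dm.derivedPoint ∈ invPoints (absoluteGaloisGroup K) dm.pointsSubgroup ((p ^ (1 + u) : ℕ) : ℤ))
    {εf : ℤ} (hεf : εf = 1 ∨ εf = -1)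
    (hsign : ∀ (τ : K ≃ₐ[ℚ] K), τ ≠ 1 → ∀ (u m : ℕ) (dm : KolyvaginFamilyData W K ι m), dm.y = ys m → Squarefree m →
      (∀ q ∈ m.primeFactors, IsKolyvaginPrime (W.conductorNorm ℤ) W K p q ∧ FrobEqFrobInfty W K (p ^ (u + 1)) q) →
      conjAct W τ ((p ^ (1 + u) : ℕ) : ℤ) (dm.kolyvaginClass (Fact.out : p.Prime) (1 + u)) =
        (εf * (-1) ^ m.primeFactors.card) • dm.kolyvaginClass (Fact.out : p.Prime) (1 + u))
    (hsel : ∀ (𝒯 : SelmerStructure ((W.baseChange K).torsionGaloisModule ((p ^ 1 : ℕ) : ℤ))),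
      (∀ v : HeightOneSpectrum (𝓞 K), 𝒯 (Sum.inr v) =
        ⨅ (ℓ : ℕ) (_ : ℓ.Prime ∧ (ℓ : 𝓞 K) ∈ v.asIdeal),
          ⨅ (w' : HeightOneSpectrum (𝓞 (ringClassField K ι ℓ)))
            (_ : w'.asIdeal.LiesOver v.asIdeal),
            letI := (adicCompletionOfLiesOver K (ringClassField K ι ℓ) v w').toAlgebra
            transverseSubgroup (GaloisRep.toLocal v ((W.baseChange K).torsionGaloisModule ((p ^ 1 : ℕ) : ℤ)))
              (w'.adicCompletion (ringClassField K ι ℓ))) →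
      ∀ (u m : ℕ) (dm : KolyvaginFamilyData W K ι m), dm.y = ys m → Squarefree m →
      (∀ q ∈ m.primeFactors, IsKolyvaginPrime (W.conductorNorm ℤ) W K p q ∧ FrobEqFrobInfty W K (p ^ (u + 1)) q) →
      ∀ (Q : (W.baseChange (ringClassField K ι m)).toAffine.Point)
      (hA1 : IsAdmissible (absoluteGaloisGroup K) dm.pointsSubgroup ((p ^ 1 : ℕ) : ℤ))
      (hQ : dm.toGeomPoints Q ∈ invPoints (absoluteGaloisGroup K) dm.pointsSubgroup ((p ^ 1 : ℕ) : ℤ)),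
      ((p ^ u : ℕ) : ℤ) • Q = dm.derivedPoint →
      kolyvaginClass (W.baseChange K) ((p ^ 1 : ℕ) : ℤ)
          ((W.baseChange K).zsmul_geomPoints_surjective_of_charZero
            (by exact_mod_cast pow_ne_zero 1 (Fact.out : p.Prime).ne_zero)) hA1 (dm.toGeomPoints Q) hQ ∈
        (selmerF W ((p ^ 1 : ℕ) : ℤ) 𝒯 (placesDividing K m)).selmerGroup)
    (h44 : ∀ (u m l : ℕ), Squarefree (m * l) → l.Prime → ¬ l ∣ m →
      (∀ q ∈ (m * l).primeFactors, IsKolyvaginPrime (W.conductorNorm ℤ) W K p q ∧ FrobEqFrobInfty W K (p ^ (u + 1)) q) →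
      ∀ (dm : KolyvaginFamilyData W K ι m) (dml : KolyvaginFamilyData W K ι (m * l)),
      dm.y = ys m → dml.y = ys (m * l) →
      ∀ (v : HeightOneSpectrum (𝓞 K)), (l : 𝓞 K) ∈ v.asIdeal →
      addOrderOf ((galoisCohomology.localization
          ((W.baseChange K).torsionGaloisModule ((p ^ (1 + u) : ℕ) : ℤ)) (Sum.inr v) 1 :
            galH1Torsion (W.baseChange K) ((p ^ (1 + u) : ℕ) : ℤ) →+ _)
          (dml.kolyvaginClass (Fact.out : p.Prime) (1 + u))) =
        addOrderOf ((galoisCohomology.localization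
          ((W.baseChange K).torsionGaloisModule ((p ^ (1 + u) : ℕ) : ℤ)) (Sum.inr v) 1 :
            galH1Torsion (W.baseChange K) ((p ^ (1 + u) : ℕ) : ℤ) →+ _)
          (dm.kolyvaginClass (Fact.out : p.Prime) (1 + u)))) :
    ∀ (μ e n : ℕ) (d : KolyvaginFamilyData W K ι n), d.y = ys n → Squarefree n →
      (∀ ℓ ∈ n.primeFactors, IsKolyvaginPrime (W.conductorNorm ℤ) W K p ℓ ∧ FrobEqFrobInfty W K (p ^ (μ + 1)) ℓ) →
      (∀ (n' : ℕ) (d' : KolyvaginFamilyData W K ι n'), d'.y = ys n' → Squarefree n' →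
        (∀ ℓ ∈ n'.primeFactors, IsKolyvaginPrime (W.conductorNorm ℤ) W K p ℓ ∧ FrobEqFrobInfty W K (p ^ (μ + 1)) ℓ) →
        d'.PDiv p μ) →
      ¬ d.PDiv p (μ + 1) →
      ∃ (n' : ℕ) (d' : KolyvaginFamilyData W K ι n'), d'.y = ys n' ∧ Squarefree n' ∧
        (∀ ℓ ∈ n'.primeFactors, IsKolyvaginPrime (W.conductorNorm ℤ) W K p ℓ ∧ FrobEqFrobInfty W K (p ^ e) ℓ) ∧
        ¬ d'.PDiv p (μ + 1) := by
  intro μ e n d hdy hn hnK hall hnot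
  have hp : p.Prime := Fact.out
  have hD : NumberField.discr K < -4 := KolyvaginAssembly.discr_lt_neg_four hK ⟨hD3, hD4⟩
  obtain ⟨τ, hτ⟩ := exists_algEquiv_ne_one_of_isImaginaryQuadratic K hK
  have hττ : τ * τ = 1 := mul_self_eq_one_of_isImaginaryQuadratic hK τ
  -- ### the pool and the target, in Gross's currency
  let KP : ℕ → Prop := fun q ↦ IsKolyvaginPrime (W.conductorNorm ℤ) W K p q ∧ FrobEqFrobInfty W K (p ^ (μ + 1)) q
  let Fine : ℕ → Prop := fun q ↦ FrobEqFrobInfty W K (p ^ e) q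
  have hKP : ∀ q, KP q → Zhang2014.IsKolyvaginPrime (W.conductorNorm ℤ) W K p q ∧
      1 + μ ≤ Zhang2014.kolyvaginIndex W p q := by
    rintro q ⟨hq, hfrob⟩
    obtain ⟨hZ, hidx⟩ := zhang_isKolyvaginPrime_of_frobEqFrobInfty W hp (by omega) hq hfrob
    exact ⟨hZ, by rwa [Nat.add_comm] at hidx⟩
  -- ### the level-`p` structural packages (bsd-jet's block, verbatim)
  haveI : NeZero (p ^ 1) := ⟨pow_ne_zero 1 hp.ne_zero⟩
  haveI : Finite (geomTorsion (W.baseChange K) ((p ^ 1 : ℕ) : ℤ)) :=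
    finite_geomTorsion_of_neZero (W.baseChange K) (p ^ 1)
  obtain ⟨inv, hperf, hvan, -, hSC, hconj⟩ := hPT K (p ^ 1)
  have h2 : 2 ≤ p ^ 1 := by rw [pow_one]; exact hp.two_le
  obtain ⟨ew, hμw, hadd₁, hadd₂, hgal, halt, hnondeg, hτe⟩ := exists_weilDatum_liftAut W τ (p ^ 1) h2
  obtain ⟨𝒯, h𝒯, -⟩ := Walk.exists_globalTransverseFamily W ι ((p ^ 1 : ℕ) : ℤ)
  have h𝒯σ' : ∀ (c : ℕ), Squarefree c →
      (∀ q ∈ c.primeFactors, Zhang2014.IsKolyvaginPrime (W.conductorNorm ℤ) W K p q) →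
      ∀ (v w : HeightOneSpectrum (𝓞 K)) (h : τ • v = w), v ∈ placesDividing K c →
      ∀ x : galoisCohomology (((W.baseChange K).torsionGaloisModule ((p ^ 1 : ℕ) : ℤ)).toLocal
        (Sum.inr v : Place K)) 1,
      x ∈ 𝒯 (Sum.inr v) → conjActPlace W τ ((p ^ 1 : ℕ) : ℤ) h x ∈ 𝒯 (Sum.inr w) :=
    fun c hc _ v w h hv x hx ↦ Walk.globalTransverse_conjActPlace_mem h𝒯 τ hc
      (forall_conjActPlace_mem_of_eq_iInf_transverseSubgroup W hK ι τ _ c) v w h hv x hx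
  have h𝒯sd' : ∀ (c : ℕ), Squarefree c →
      (∀ q ∈ c.primeFactors, Zhang2014.IsKolyvaginPrime (W.conductorNorm ℤ) W K p q) →
      ∀ v ∈ placesDividing K c,
      inv.dualTransported 𝒯 (weilDualIntertwining (W.baseChange K) (p ^ 1) ew hμw hadd₁ hadd₂ hgal)
        (Sum.inr v) = 𝒯 (Sum.inr v) :=
    fun c hc hcK ↦ Walk.globalTransverse_dualTransported_eq (ι := ι) h𝒯 hc
      (fun 𝒯c h𝒯c inv' hperf' w' hw' ↦
        RingClassTransverse.dualTransported_eq_of_localTransverseFamily W K hK hD ι p hp2 1 le_rfl c hc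
          hcK (fun ℓ hℓ ↦ (hcK ℓ hℓ).2.2.2.2.2) 𝒯c h𝒯c ew hμw hadd₁ hadd₂ hgal halt hnondeg inv' hperf' w' hw')
      inv hperf
  have hloc' : ∀ ℓ : ℕ, Zhang2014.IsKolyvaginPrime (W.conductorNorm ℤ) W K p ℓ →
      1 ≤ Zhang2014.kolyvaginIndex W p ℓ →
      ∀ (v : HeightOneSpectrum (𝓞 K)), (ℓ : 𝓞 K) ∈ v.asIdeal → ∀ (hfix : τ • v = v) (s : ℤ),
      (s = 1 ∨ s = -1) →
      ((W.baseChange K).kummerSelmerStructure ((p ^ 1 : ℕ) : ℤ) (Sum.inr v)).relIndex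
        ((conjActPlace W τ ((p ^ 1 : ℕ) : ℤ) hfix - s • AddMonoidHom.id _).ker) = p ^ 1 :=
    fun ℓ hℓ hk v hv hfix s hs ↦
      kolyvaginLocalTerm_of_poitouTate hPT W K hK τ hτ p 1 hp2 le_rfl ℓ hℓ hk v hv hfix s hs
  have hdisj' : ∀ ℓ : ℕ, Zhang2014.IsKolyvaginPrime (W.conductorNorm ℤ) W K p ℓ →
      ∀ v : HeightOneSpectrum (𝓞 K), (ℓ : 𝓞 K) ∈ v.asIdeal →
      Disjoint ((W.baseChange K).kummerSelmerStructure ((p ^ 1 : ℕ) : ℤ) (Sum.inr v)) (𝒯 (Sum.inr v)) :=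
    fun ℓ hℓ v hv ↦ Walk.globalTransverse_disjoint_kummer h𝒯
      (P := fun ℓ ↦ Zhang2014.IsKolyvaginPrime (W.conductorNorm ℤ) W K p ℓ)
      (fun ℓ hℓ w hw ↦ Walk.disjoint_kummer_iInf_transverseSubgroup W K hK hD ι 1 hℓ w hw)
      (fun ℓ hℓ ↦ hℓ.1) ℓ hℓ v hv
  -- ### the Čebotarev supply in the pool-and-target shape (shift `j := μ + e`)
  have hceb' : ∀ (e₁ : ℤ), (e₁ = 1 ∨ e₁ = -1) →
      ∀ (x y : galoisCohomology ((W.baseChange K).torsionGaloisModule ((p ^ 1 : ℕ) : ℤ)) 1),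
      conjAct W τ ((p ^ 1 : ℕ) : ℤ) x = e₁ • x → conjAct W τ ((p ^ 1 : ℕ) : ℤ) y = (-e₁) • y → y ≠ 0 →
      ∀ (b : ℕ), ∃ ℓ : ℕ, b < ℓ ∧ KP ℓ ∧ Fine ℓ ∧
        ∀ v : HeightOneSpectrum (𝓞 K), (ℓ : 𝓞 K) ∈ v.asIdeal →
          addOrderOf (galoisCohomology.localization
              ((W.baseChange K).torsionGaloisModule ((p ^ 1 : ℕ) : ℤ)) (Sum.inr v) 1 x) = addOrderOf x ∧
          addOrderOf (galoisCohomology.localization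
              ((W.baseChange K).torsionGaloisModule ((p ^ 1 : ℕ) : ℤ)) (Sum.inr v) 1 y) = addOrderOf y := by
    intro e₁ he₁ x y hx hy hy0 b
    obtain ⟨ℓ, hbℓ, hKol, hfrob, hord⟩ := hceb τ hτ (μ + e) e₁ he₁ x y hx hy hy0 b
    exact ⟨ℓ, hbℓ, ⟨hKol, hfrob.of_dvd (pow_dvd_pow p (by omega))⟩, hfrob.of_dvd (pow_dvd_pow p (by omega)), hord⟩
  -- ### presentations for free; the dictionary restricted to the pool at depth `μ`
  have hdata : ∀ (m : ℕ), Squarefree m → (∀ q ∈ m.primeFactors, KP q) →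
      ∃ dm : KolyvaginFamilyData W K ι m, dm.y = ys m :=
    fun m hm hmKP ↦ ShimuraWalk.exists_familyData_y_eq (W := W) hK ι hm (fun q hq ↦ (hmKP q hq).1.2.2.2.2.1) ys
  -- ### the walk (file 4)
  obtain ⟨n', d', hd'y, hn', hn'F, hn'd⟩ := exists_conductor_fine_of_minDepth_family W τ p ew hμw hadd₁ hadd₂ hgal halt hnondeg
    hτe hK hp2 hττ ys inv hperf hvan hSC (hconj τ) 𝒯 h𝒯σ' h𝒯sd' hloc' hdisj' hbot KP Fine hKP hceb' hdata
    (fun m dm hdm hm hmKP ↦ hA μ m dm hdm hm hmKP) (fun m dm hdm hm hmKP ↦ hP μ m dm hdm hm hmKP) hεf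
    (fun m dm hdm hm hmKP ↦ hsign τ hτ μ m dm hdm hm hmKP)
    (fun m dm hdm hm hmKP Q hA1 hQ hQP ↦ hsel 𝒯 h𝒯 μ m dm hdm hm hmKP Q hA1 hQ hQP)
    (fun m l hml hl hlm hmlKP dm dml hdm hdml v hv ↦ h44 μ m l hml hl hlm hmlKP dm dml hdm hdml v hv)
    (fun m dm hdm hm hmKP ↦ hall m dm hdm hm hmKP) hn hnK d hdy hnot
  exact ⟨n', d', hd'y, hn', fun q hq ↦ ⟨(hn'F q hq).1.1, (hn'F q hq).2⟩, hn'd⟩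

/-- **`ShimuraWalk.SwapSupplyAt hK ι W N_E p ys` for an arbitrary family** from the inputs of `familySwapSupply_of_dictionary` and the weak
(B4) label of `ys` (through corner3-p2 g8's end glue `ShimuraWalk.swapSupplyAt_of_familySwapSupply`, whose dictionary needs the frame `Dt`).
CONDITIONAL. [cite: McCallumLMS1991, §5 Prop. 5.2] [cite: GrossLMS1991, §3 (3.2)–(3.3), Prop. 3.6] -/
theorem shimuraWalk_swapSupplyAt_of_family
    (hPT : ∀ (K : Type) [Field K] [NumberField K], poitouTate_selmerStructure_duality_conj K)
    (hK : IsImaginaryQuadratic K) (hD3 : NumberField.discr K ≠ -3) (hD4 : NumberField.discr K ≠ -4)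
    (p : ℕ) [Fact p.Prime] (hp2 : p ≠ 2) (ι : K →+* ℂ) [∀ j : ℕ, NumberField (ringClassField K ι j)]
    (Dt : ModularParametrizationData W (W.conductorNorm ℤ))
    (ys : (m : ℕ) → (W.baseChange (ringClassField K ι m)).toAffine.Point)
    (hbot : AddSubgroup.torsionBy (W.baseChange K).toAffine.Point (p : ℤ) = ⊥)
    (hB4 : ∀ k : ℕ, Squarefree k → (∀ q ∈ k.primeFactors, IsKolyvaginPrime (W.conductorNorm ℤ) W K p q) →
      ∀ ℓ ∈ k.primeFactors, ∀ σ : ringClassField K ι k ≃ₐ[ℚ] ringClassField K ι k,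
      Subgroup.zpowers σ = ringClassGalOver ι k (k / ℓ) →
      ∃ y' : (W.baseChange (ringClassField K ι k)).toAffine.Point,
        ∑ i ∈ Finset.range (ℓ + 1), pointGalHom W (ringClassField K ι k) (σ ^ i) (ys k) =
          W.frobeniusTrace ℓ • y')
    (hceb : ∀ (τ : K ≃ₐ[ℚ] K), τ ≠ 1 → ∀ (j : ℕ) (e₁ : ℤ), (e₁ = 1 ∨ e₁ = -1) →
      ∀ (x y : galoisCohomology ((W.baseChange K).torsionGaloisModule ((p ^ 1 : ℕ) : ℤ)) 1),
      conjAct W τ ((p ^ 1 : ℕ) : ℤ) x = e₁ • x → conjAct W τ ((p ^ 1 : ℕ) : ℤ) y = (-e₁) • y → y ≠ 0 →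
      ∀ (b : ℕ), ∃ ℓ : ℕ, b < ℓ ∧ IsKolyvaginPrime (W.conductorNorm ℤ) W K p ℓ ∧ FrobEqFrobInfty W K (p ^ (1 + j)) ℓ ∧
        ∀ v : HeightOneSpectrum (𝓞 K), (ℓ : 𝓞 K) ∈ v.asIdeal →
          addOrderOf (galoisCohomology.localization
              ((W.baseChange K).torsionGaloisModule ((p ^ 1 : ℕ) : ℤ)) (Sum.inr v) 1 x) = addOrderOf x ∧
          addOrderOf (galoisCohomology.localization
              ((W.baseChange K).torsionGaloisModule ((p ^ 1 : ℕ) : ℤ)) (Sum.inr v) 1 y) = addOrderOf y)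
    (hA : ∀ (u m : ℕ) (dm : KolyvaginFamilyData W K ι m), dm.y = ys m → Squarefree m →
      (∀ q ∈ m.primeFactors, IsKolyvaginPrime (W.conductorNorm ℤ) W K p q ∧ FrobEqFrobInfty W K (p ^ (u + 1)) q) →
      IsAdmissible (absoluteGaloisGroup K) dm.pointsSubgroup ((p ^ (1 + u) : ℕ) : ℤ))
    (hP : ∀ (u m : ℕ) (dm : KolyvaginFamilyData W K ι m), dm.y = ys m → Squarefree m →
      (∀ q ∈ m.primeFactors, IsKolyvaginPrime (W.conductorNorm ℤ) W K p q ∧ FrobEqFrobInfty W K (p ^ (u + 1)) q) →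
      dm.toGeomPoints dm.derivedPoint ∈ invPoints (absoluteGaloisGroup K) dm.pointsSubgroup ((p ^ (1 + u) : ℕ) : ℤ))
    {εf : ℤ} (hεf : εf = 1 ∨ εf = -1)
    (hsign : ∀ (τ : K ≃ₐ[ℚ] K), τ ≠ 1 → ∀ (u m : ℕ) (dm : KolyvaginFamilyData W K ι m), dm.y = ys m → Squarefree m →
      (∀ q ∈ m.primeFactors, IsKolyvaginPrime (W.conductorNorm ℤ) W K p q ∧ FrobEqFrobInfty W K (p ^ (u + 1)) q) →
      conjAct W τ ((p ^ (1 + u) : ℕ) : ℤ) (dm.kolyvaginClass (Fact.out : p.Prime) (1 + u)) =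
        (εf * (-1) ^ m.primeFactors.card) • dm.kolyvaginClass (Fact.out : p.Prime) (1 + u))
    (hsel : ∀ (𝒯 : SelmerStructure ((W.baseChange K).torsionGaloisModule ((p ^ 1 : ℕ) : ℤ))),
      (∀ v : HeightOneSpectrum (𝓞 K), 𝒯 (Sum.inr v) =
        ⨅ (ℓ : ℕ) (_ : ℓ.Prime ∧ (ℓ : 𝓞 K) ∈ v.asIdeal),
          ⨅ (w' : HeightOneSpectrum (𝓞 (ringClassField K ι ℓ)))
            (_ : w'.asIdeal.LiesOver v.asIdeal),
            letI := (adicCompletionOfLiesOver K (ringClassField K ι ℓ) v w').toAlgebra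
            transverseSubgroup (GaloisRep.toLocal v ((W.baseChange K).torsionGaloisModule ((p ^ 1 : ℕ) : ℤ)))
              (w'.adicCompletion (ringClassField K ι ℓ))) →
      ∀ (u m : ℕ) (dm : KolyvaginFamilyData W K ι m), dm.y = ys m → Squarefree m →
      (∀ q ∈ m.primeFactors, IsKolyvaginPrime (W.conductorNorm ℤ) W K p q ∧ FrobEqFrobInfty W K (p ^ (u + 1)) q) →
      ∀ (Q : (W.baseChange (ringClassField K ι m)).toAffine.Point)
      (hA1 : IsAdmissible (absoluteGaloisGroup K) dm.pointsSubgroup ((p ^ 1 : ℕ) : ℤ))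
      (hQ : dm.toGeomPoints Q ∈ invPoints (absoluteGaloisGroup K) dm.pointsSubgroup ((p ^ 1 : ℕ) : ℤ)),
      ((p ^ u : ℕ) : ℤ) • Q = dm.derivedPoint →
      kolyvaginClass (W.baseChange K) ((p ^ 1 : ℕ) : ℤ)
          ((W.baseChange K).zsmul_geomPoints_surjective_of_charZero
            (by exact_mod_cast pow_ne_zero 1 (Fact.out : p.Prime).ne_zero)) hA1 (dm.toGeomPoints Q) hQ ∈
        (selmerF W ((p ^ 1 : ℕ) : ℤ) 𝒯 (placesDividing K m)).selmerGroup)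
    (h44 : ∀ (u m l : ℕ), Squarefree (m * l) → l.Prime → ¬ l ∣ m →
      (∀ q ∈ (m * l).primeFactors, IsKolyvaginPrime (W.conductorNorm ℤ) W K p q ∧ FrobEqFrobInfty W K (p ^ (u + 1)) q) →
      ∀ (dm : KolyvaginFamilyData W K ι m) (dml : KolyvaginFamilyData W K ι (m * l)),
      dm.y = ys m → dml.y = ys (m * l) →
      ∀ (v : HeightOneSpectrum (𝓞 K)), (l : 𝓞 K) ∈ v.asIdeal →
      addOrderOf ((galoisCohomology.localization
          ((W.baseChange K).torsionGaloisModule ((p ^ (1 + u) : ℕ) : ℤ)) (Sum.inr v) 1 :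
            galH1Torsion (W.baseChange K) ((p ^ (1 + u) : ℕ) : ℤ) →+ _)
          (dml.kolyvaginClass (Fact.out : p.Prime) (1 + u))) =
        addOrderOf ((galoisCohomology.localization
          ((W.baseChange K).torsionGaloisModule ((p ^ (1 + u) : ℕ) : ℤ)) (Sum.inr v) 1 :
            galH1Torsion (W.baseChange K) ((p ^ (1 + u) : ℕ) : ℤ) →+ _)
          (dm.kolyvaginClass (Fact.out : p.Prime) (1 + u)))) :
    ShimuraWalk.SwapSupplyAt hK ι W (W.conductorNorm ℤ) p ys :=
  ShimuraWalk.swapSupplyAt_of_familySwapSupply hK ι Dt (Fact.out : p.Prime) ys hB4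
    (familySwapSupply_of_dictionary W hPT hK hD3 hD4 p hp2 ι ys hbot hceb hA hP hεf hsign hsel h44)

end Summit.BirchSwinnertonDyer.Rank1Residual.JET.Swap

end
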